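import Summits.BirchSwinnertonDyer.Rank1Residual.X11a.PrintDischargeKimDeep
import Summits.BirchSwinnertonDyer.Rank1Residual.X11b.ChaPairs1
import Summits.BirchSwinnertonDyer.Rank1Residual.Supersingular.IntModelMinimalityKrausTwoMore
import Summits.BirchSwinnertonDyer.Rank1Residual.X11b.CertificateCheckBridge
import HarnessLib

/-!
# Class X11a, surjective leaf, Tamagawa-defect pairs: per-pair DEEP Kurihara-number record (Kim 2026
# Thm. 1.8 (6) beyond the unit case) — `320045bh1 @ 5` (cell `bsd-print-x11a`, seat p1 g4; `--supports`
# item stmt-BirchSwinnertonDyer-19064, helper; engine M = EXACT eclib modular symbols, kit job j288451)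

HONEST FRAMING (cells `b2b-bsdres` / `bsd-print-x11a`, verbatim): the goal is to DELETE the
COMBINATION-SHAPED residual classes of the Birch–Swinnerton-Dyer formula for ALL analytic-rank
`≤ 1` elliptic curves over `ℚ` — "full BSD formula for every rank `≤ 1` curve in class `C`"
assembled STRICTLY from published theorems — so that the rank-`≤ 1` remainder becomes exactly the
CONSTRUCTION-SHAPED classes, which are TYPED (missing-input `Prop`s), NOT attempted. This is not
"finishing BSD". PER PAIR: theorems only, no definition, no named fact; nothing is booked by this
file and no class label changes (referee / planner; two engines + REF per cell rules — this record is
SINGLE-ENGINE until a second engine reproduces the value). The CLASS-level lower half (crux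
`PrintX11a.X11aLowerHalf` = item stmt-BirchSwinnertonDyer-19064) stays OPEN.

## What

Sibling of `X11a/KimDeepRecords1.lean` (375440db1, p555920) and
`Theorems/PrintX11aLowerHalfKimDeepRecord285660u.lean` (p556936): the door
`ClassX11a.missingLowerBoundAt_of_kimDeep` / `ClassX11a.bsdp_of_kimDeep` (`X11a/PrintDischargeKimDeep.lean`,
p548893: Kim, Amer. J. Math. 148 (2026) Thm. 1.8 (6) BEYOND THE UNIT CASE, in its LITERAL form
`Kim2026.rankZero_le_padicValNat_sha_of_kuriharaNumber_ne_zero` — the curve is SPLIT multiplicative at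
`5` with `5 ∣ v₅(Δ_min) = 5`, so the `(t0)` twin is not automatic; the literal fact carries the registry
flag `K26-(6)-shallow@t>0`, whose exposure is depth `k ≤ t`, and here `k = 2 ≥ 1 + t` since
`t = ord₅ #E(ℚ₅)[5^∞] ≤ ord₅ c₅ = 1`) at the pair
`320045bh1 @ 5` — one of the six surjective leaf pairs of X11a with `N < 5·10⁵` and TAMAGAWA DEFECT
(`∏ c_ℓ = 10`: `c₅ = 5` (split, `v₅(Δ) = 5`), `c₁₁ = 1`, `c₂₃ = 2`; the unit-Kurihara door is empty there by Kim's Conjecture 1.10,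
`∂^{(∞)} = Σ ord₅ c_ℓ = 1`), out of reach of the twisted-`L` engines (cost `∝ n√N`, `n ≈ 10⁷`) and fed
here by ENGINE M of kit job j288451 (seat p1 g4): the plus modular symbol of the curve computed EXACTLY by
eclib (Sage 10.9 `modular_symbol(+1, implementation = "eclib")`, space at level `N = 320045` built in
`1083.2` s), rescaled so that `[0]⁺ = L(E,1)/Ω_E = 250` (`= #Ш_an·∏c_ℓ/#tors²`, Cremona
`allbsd`; raw eclib value `250/1`, scale `1/1`), least primitive roots `η_ℓ`, the sum over
`1 ≤ a ≤ n/2` doubled (symmetry `[a/n]⁺ = [(n−a)/n]⁺` re-verified on 400 random `a`, 0 violations). Engine M was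
validated byte-for-byte against the independent twisted-`L` engine kur2 of the two sibling records (kit j287849:
symbol tables of 375440db1 at `n = 1887751` (942500 lines) and 285660u1 at `n = 902651` (450000 lines)
IDENTICAL, sha256 `997069123c795753…` / `e20c00664c32171b…`, `δ̃ ≡ 10`, `5 (mod 25)` reproduced).

  `n = 38213551 = 4001 · 9551`, both `ℓ ∈ 𝒫₂` (`ℓ ∤ 5N`, `ℓ ≡ 1 (mod 25)`, `a_ℓ ≡ ℓ + 1 (mod 25)`:
  `a₄₀₀₁ = 2`, `a₉₅₅₁ = -123`), `Ẽ(𝔽₄₀₀₁) ≅ ℤ/4000`, `Ẽ(𝔽₉₅₅₁) ≅ ℤ/9675`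
  (`5`-parts cyclic: `#Ẽ(𝔽_ℓ)[5] = 5`), least primitive roots `η = 3, 11`, `19100000` symbols
  (`a ≤ n/2`), largest denominator `2`, table sha256 `e30508524cca9d2d49735f929468ecf93d7c8f3b28a6cb5a6b5d59593a72d3d9`
  (sha256 of the lines `a:num/den`, the kur2 convention), and
  **`δ̃_n ≡ 10 (mod 25)`** — `≡ 0 (mod 5)` as forced by `dim Sel₅ = 2` and the defect, `≢ 0 (mod 25)`:
  `ord₅ δ̃_n = 1 = ∂^{(∞)}`; `[0]⁺ = 250 = 2·5³`.
  Further levels of the same job (engine M, exact; 𝒫₂ cyclic primes 4001, 5651, 9551, 14551, 21851,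
  36251 — 33751 ∈ 𝒫₂ is NOT cyclic, `Ẽ(𝔽₃₃₇₅₁) ≅ ℤ/5 × ℤ/6740`): `δ̃ ≡ 10` at `n = 5651·9551`, `≡ 15` at
  `4001·21851` and `5651·21851`, and `≡ 0 (mod 25)` at `4001·5651`, `4001·14551`, `5651·14551`,
  `9551·14551` (all `≡ 0 (mod 5)`, as they must). Internal checks at every level: the Hecke
  eigen-relations `a_q·[x]⁺ = [qx]⁺ + Σ_{b mod q} [(x+b)/q]⁺` for `q = 3, 7` on 30 random `x = a/n`
  (0 violations) — the evaluated functional is the `T_q`-eigenvector with `E`'s eigenvalues.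

KERNEL (as in the siblings): `Δ ≠ 0` (elliptic), global minimality (Kraus, complete factorisation
`|Δ| = 5⁵·11⁴·23⁹`), `5 ∣ Δ ∧ 5 ∤ c₄` (multiplicative at `5`), `E[5]` irreducible by the Frobenius
witness `#Ẽ(𝔽₃) = 6` (`a₃ = -2`, `X² + 2X + 3` root-free mod `5`; Mazur 1978 Prop. 6.3 (1)),
`ord₅ ∏ c_ℓ ≥ 1` from the displayed `∏ c_ℓ = 10`. DISPLAYED (Cremona `allcurves`/`allbsd`/`galrep` =
ty3's `RecordsLeafSurjN500000Part*` record of the pair, and the certificate; exactly the door's binders):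
`r_an = 0`; `¬ Ram W 5` (no other multiplicative prime (`11`, `23` additive)); `ρ̄_{E,5}` onto (Cremona/Sutherland galrep: no
non-surjective prime); SPLIT at `5` (`a₅ = 1`); `∏ c_ℓ = 10`; a modular parametrisation
datum `D` with `5 ∤ c_D` (`320045bh1` is the `X₀(N)`-optimal curve of its one-curve class and `25 ∤ N =
5·11²·23²`: Mazur 1978 Cor. 4.1); the Kolyvagin level `n = 38213551 ∈ 𝒩₂` with cyclic reductions;
surjective discrete logarithms `ψ ↠ ℤ/25`; and the certificate `kuriharaNumber D.f 25 38213551 ψ ≠ 0`.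
Theorems: `mlb5_c320045bh1` (`Typed.MissingLowerBoundAt W 5` = crux 19064's currency at the pair) and
`bsdp5_c320045bh1` (`BSDp W 5`, with Wuthrich 2014 Prop. 21 for the Euler half). Evidence: kit job j288451
outputs (`records.jsonl`, `summary.txt`), memo `kit/RESULTS-engM-deep.md` (seat folder, attached to item
19064), HOME/P1-ROAD.md §9, HOME/STATUS.md.

References: [Kim2022StructureSelmer] Thm. 1.9 (6) (= journal Thm. 1.8 (6)), §1.5.1, Conj. 1.10;
[Mazur1978] Prop. 6.3 (1), Cor. 4.1; [Wuthrich2014] Prop. 21; [Miller2011LMS] Def. 1.1;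
[SilvermanAEC2009] VII.1 Rem. 1.1, VII.5.1; [Kraus1989]; [Cremona2006] (label 320045bh1).
-/

set_option linter.dupNamespace false -- the directory name repeats the summit name (sibling precedent)

set_option autoImplicit false

noncomputable section

open scoped Classical

open WeierstrassCurve Literature.NumberTheory.EllipticCurves
  Literature.NumberTheory.EllipticCurves.ModularForms
  Literature.NumberTheory.EllipticCurves.Rank1Residual
  Literature.NumberTheory.EllipticCurves.Rank1Residual.Typed
  Literature.NumberTheory.EllipticCurves.Rank1Residual.X11RankOneCertificates
  Literature.NumberTheory.EllipticCurves.Wuthrich2014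
  NumberField IsDedekindDomain Rat.HeightOneSpectrum
  Summit.BirchSwinnertonDyer.BirchSwinnertonDyer.Rank1Residual.IntModel
  Summit.BirchSwinnertonDyer.BirchSwinnertonDyer.Rank1Residual.X11RankOne
  Summit.BirchSwinnertonDyer.Rank1Residual.Supersingular

namespace Summit.BirchSwinnertonDyer.BirchSwinnertonDyer.Theorems.KimDeep

open Summit.BirchSwinnertonDyer.Rank1Residual

/-! ### `320045bh1 @ 5` (`N = 320045 = 5·11²·23²`, `ρ̄_{E,5}` onto, SPLIT multiplicative at `5`,
`∏ c_ℓ = 10`, `#E(ℚ)_tors = 1`, `#Ш_an = 25`) -/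

/-- `320045bh1 = [0, 1, 1, -600169720, -5659454700619]` is globally minimal: `|Δ| = 5⁵·11⁴·23⁹` (kernel) + Kraus
(every exponent `< 12`).
[cite: SilvermanAEC2009, VII.1 Remark 1.1] [cite: Kraus1989, Prop. 1 and Prop. 2] -/
theorem isGloballyMinimal_c320045bh1 :
    (⟨0, 1, 1, -600169720, -5659454700619⟩ : WeierstrassCurve ℚ).IsGloballyMinimal :=
  isGloballyMinimal_of_krausCriterion₃_factored 0 1 1 (-600169720) (-5659454700619)
    [(5, 5), (11, 4), (23, 9)] (by decide +kernel)
    (by intro qe hqe; simp only [List.mem_cons, List.not_mem_nil, or_false] at hqe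
        rcases hqe with rfl | rfl | rfl <;> norm_num)
    (by intro qe hqe; simp only [List.mem_cons, List.not_mem_nil, or_false] at hqe
        rcases hqe with rfl | rfl | rfl
        · exact Or.inl (by decide +kernel)
        · exact Or.inl (by decide +kernel)
        · exact Or.inl (by decide +kernel))

/-- `320045bh1` is an elliptic curve: `|Δ| = 5⁵·11⁴·23⁹ ≠ 0` (kernel). [folklore] -/
theorem isElliptic_c320045bh1 :
    (⟨0, 1, 1, -600169720, -5659454700619⟩ : WeierstrassCurve ℚ).IsElliptic :=
  X11b.isElliptic_of_discOf_ne_zero 0 1 1 (-600169720) (-5659454700619) (by decide +kernel)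

/-- `#Ẽ(𝔽₃) = 6` for `320045bh1` (`a₃ = -2`; `X² − a₃X + 3` is root-free mod `5`: the Frobenius
irreducibility witness, kernel count `countPoints`). [folklore] -/
theorem card_c320045bh1_3 :
    Nat.card (((⟨0, 1, 1, -600169720, -5659454700619⟩ : WeierstrassCurve ℤ).map
      (Int.castRingHom (ZMod 3))).toAffine.Point) = 6 := by
  have h := X11b.natCard_point_eq_countPoints 0 1 1 (-600169720) (-5659454700619) 3 (by norm_num)
    (by decide +kernel)
  have h' : countPoints [0, 1, 1, -600169720, -5659454700619] 3 = 6 := by decide +kernel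
  exact_mod_cast h.trans h'

/-- **`320045bh1 @ 5`: the LOWER half `ord₅ #Ш_an ≤ ord₅ #Ш`** (`Typed.MissingLowerBoundAt W 5`, the
currency of crux `X11aLowerHalf` = item 19064, at this pair) from the DEEP Kurihara certificate of kit
job j288451 (engine M, exact eclib symbols: `δ̃_{4001·9551} ≡ 10 (mod 25)`, level `k = 2 ≤ ord₅ ∏ c_ℓ + 1`)
through the door `ClassX11a.missingLowerBoundAt_of_kimDeep` (Kim 2026 Thm. 1.8 (6) beyond the unit
case, literal fact `hKim`; period transfer `hϖ`; GZK; modularity `hmod`). KERNEL (instances supplied by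
`isElliptic_c320045bh1`, `isGloballyMinimal_c320045bh1`): multiplicative at `5`, `E[5]` irreducible
(`card_c320045bh1_3`), `ord₅ ∏ c_ℓ ≥ 1` from `htam`. DISPLAYED: `r_an = 0`, `¬ Ram`, `ρ̄` onto,
`∏ c_ℓ = 10`, the datum `D` with `5 ∤ c_D` (optimal curve, Mazur Cor. 4.1), `n = 38213551 ∈ 𝒩₂` with cyclic
reductions (`#Ẽ(𝔽₄₀₀₁) = 4000`, `#Ẽ(𝔽₉₅₅₁) = 9675`), `ψ ↠ ℤ/25`, and the certificate. PER PAIR;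
single-engine; nothing booked. [cite: Kim2022StructureSelmer, Thm. 1.9 (6) (PDF p. 8) and §1.5.1]
[cite: Mazur1978, §6 Prop. 6.3 (1) (p. 153) and Cor. 4.1] [cite: Miller2011LMS, Def. 1.1]
[cite: Cremona2006, Table 1 (Cremona label 320045bh1)] -/
theorem mlb5_c320045bh1
    (hKim : Kim2026.rankZero_le_padicValNat_sha_of_kuriharaNumber_ne_zero)
    (hϖ : realPeriodRat_eq_unit_mul_plusPeriod_of_multiplicative)
    (hGZK : rank_eq_analyticRank_of_analyticRank_le_one) (hmod : hasEntireLFunction_rat)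
    (W : WeierstrassCurve ℚ) [W.IsElliptic] [W.IsGloballyMinimal]
    (hW : W = ⟨0, 1, 1, -600169720, -5659454700619⟩) (hr : W.analyticRank = 0) (hnram : ¬ Ram W 5) (hsurj : Surj W 5)
    (htam : W.tamagawaProduct = 10)
    {N : ℕ} [NeZero N] (D : ModularParametrizationData W N) (hc : ¬ (5 : ℤ) ∣ D.maninConstant)
    (hn : Kato.IsKolyvaginProduct W 5 2 38213551)
    (hcyc : ∀ (ℓ : ℕ) [Fact ℓ.Prime], ℓ ∣ 38213551 →
      Nat.card {P : ((WeierstrassCurve.integralModelInt W).map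
          (Int.castRingHom (ZMod ℓ))).toAffine.Point // 5 • P = 0} ≤ 5)
    (ψ : (ℓ : ℕ) → (ZMod ℓ)ˣ →* Multiplicative (ZMod (5 ^ 2)))
    (hψ : ∀ ℓ ∈ (38213551 : ℕ).primeFactors, Function.Surjective (ψ ℓ))
    (hδ : kuriharaNumber D.f (5 ^ 2) 38213551 ψ ≠ 0) : MissingLowerBoundAt W 5 := by
  haveI : Fact (Nat.Prime 5) := ⟨by norm_num⟩
  haveI : Fact (Nat.Prime 3) := ⟨by norm_num⟩
  haveI : NeZero (38213551 : ℕ) := ⟨by norm_num⟩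
  have hI' : integralModelInt W = ⟨0, 1, 1, -600169720, -5659454700619⟩ := by
    subst hW; exact integralModelInt_eq_of_map_eq _ (map_mk_int 0 1 1 (-600169720) (-5659454700619))
  have hmult : Mult W 5 :=
    hasMultiplicativeReductionAtPrime_of_intModel hI' 5 (by decide +kernel) (by decide +kernel)
  have hirr : Irr W 5 :=
    hasIrreducibleModPGaloisRep_of_intModel_of_noroot (hp := ⟨by norm_num⟩) (hℓ := ⟨by norm_num⟩)
      hI' 5 3 (by norm_num) (by decide +kernel) card_c320045bh1_3 (by decide)
  have hX : ClassX11a W 5 := ⟨hr, by norm_num, hmult, hirr, hnram⟩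
  have hkc : 2 ≤ padicValNat 5 W.tamagawaProduct + 1 := by
    have h1 : 1 ≤ padicValNat 5 W.tamagawaProduct := by
      rw [htam]; exact one_le_padicValNat_of_dvd (by norm_num) (by norm_num)
    omega
  exact hX.missingLowerBoundAt_of_kimDeep hKim hϖ hGZK hmod le_rfl hsurj D hc
    2 38213551 (by norm_num) hkc hn hcyc ψ hψ hδ

/-- **`BSD(320045bh1, 5)`** from the same certificate: the lower half of `mlb5_c320045bh1` plus the
Euler half at surjective image (Wuthrich 2014 Prop. 21, `hWu`), through
`ClassX11a.bsdp_of_kimDeep`. PER PAIR; single-engine; nothing booked.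
[cite: Wuthrich2014, Prop. 21 (p. 400)] [cite: Kim2022StructureSelmer, Thm. 1.9 (6) (PDF p. 8)]
[cite: Miller2011LMS, Def. 1.1] [cite: Cremona2006, Table 1 (Cremona label 320045bh1)] -/
theorem bsdp5_c320045bh1 (hWu : sha_dvd_analyticSha)
    (hKim : Kim2026.rankZero_le_padicValNat_sha_of_kuriharaNumber_ne_zero)
    (hϖ : realPeriodRat_eq_unit_mul_plusPeriod_of_multiplicative)
    (hGZK : rank_eq_analyticRank_of_analyticRank_le_one) (hmod : hasEntireLFunction_rat)
    (W : WeierstrassCurve ℚ) [W.IsElliptic] [W.IsGloballyMinimal]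
    (hW : W = ⟨0, 1, 1, -600169720, -5659454700619⟩) (hr : W.analyticRank = 0) (hnram : ¬ Ram W 5) (hsurj : Surj W 5)
    (htam : W.tamagawaProduct = 10)
    {N : ℕ} [NeZero N] (D : ModularParametrizationData W N) (hc : ¬ (5 : ℤ) ∣ D.maninConstant)
    (hn : Kato.IsKolyvaginProduct W 5 2 38213551)
    (hcyc : ∀ (ℓ : ℕ) [Fact ℓ.Prime], ℓ ∣ 38213551 →
      Nat.card {P : ((WeierstrassCurve.integralModelInt W).map
          (Int.castRingHom (ZMod ℓ))).toAffine.Point // 5 • P = 0} ≤ 5)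
    (ψ : (ℓ : ℕ) → (ZMod ℓ)ˣ →* Multiplicative (ZMod (5 ^ 2)))
    (hψ : ∀ ℓ ∈ (38213551 : ℕ).primeFactors, Function.Surjective (ψ ℓ))
    (hδ : kuriharaNumber D.f (5 ^ 2) 38213551 ψ ≠ 0) : BSDp W 5 := by
  haveI : Fact (Nat.Prime 5) := ⟨by norm_num⟩
  haveI : Fact (Nat.Prime 3) := ⟨by norm_num⟩
  haveI : NeZero (38213551 : ℕ) := ⟨by norm_num⟩
  have hI' : integralModelInt W = ⟨0, 1, 1, -600169720, -5659454700619⟩ := by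
    subst hW; exact integralModelInt_eq_of_map_eq _ (map_mk_int 0 1 1 (-600169720) (-5659454700619))
  have hmult : Mult W 5 :=
    hasMultiplicativeReductionAtPrime_of_intModel hI' 5 (by decide +kernel) (by decide +kernel)
  have hirr : Irr W 5 :=
    hasIrreducibleModPGaloisRep_of_intModel_of_noroot (hp := ⟨by norm_num⟩) (hℓ := ⟨by norm_num⟩)
      hI' 5 3 (by norm_num) (by decide +kernel) card_c320045bh1_3 (by decide)
  have hX : ClassX11a W 5 := ⟨hr, by norm_num, hmult, hirr, hnram⟩
  have hkc : 2 ≤ padicValNat 5 W.tamagawaProduct + 1 := by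
    have h1 : 1 ≤ padicValNat 5 W.tamagawaProduct := by
      rw [htam]; exact one_le_padicValNat_of_dvd (by norm_num) (by norm_num)
    omega
  exact hX.bsdp_of_kimDeep hWu hKim hϖ hGZK hmod le_rfl hsurj D hc
    2 38213551 (by norm_num) hkc hn hcyc ψ hψ hδ

end Summit.BirchSwinnertonDyer.BirchSwinnertonDyer.Theorems.KimDeep

end
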